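import Mathlib
import Summits.Ventures.PercRepro2.TypedTwoDominates
import Summits.Ventures.PercRepro2.TypedPendant
import Summits.Ventures.PercRepro2.TypedClosed
import Summits.Ventures.PercRepro2.TypedPendantA3

/-!
# (T23) at the reducible edges (blind cell PercRepro2, night-3 g6, 2026-08-25)

The candidate row (T23) `N_{τ[e:=2]} ≥ N_{τ[e:=3]}` (`TypedTwoDominates.lean`) is a THEOREM at every
edge the typed reduction calculus removes, given row 2′TRI one instance down:

* unmarked leaf (`typedCount_unmarked_leaf`): `N_k = C(3,k)·N_0`, so `N_2 − N_3 = 2·N_0 ≥ 0`;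
* typed loop (`typedCount_loop`): the same;
* pendant `b` / `o` (`typedCount_pendant_b/_o`): `N_k = C(2,k−1)·N_3`, so `N_2 − N_3 = N_3 ≥ 0`;
* root pair (`typedCount_root_pair`): `N_2 = N_3 = 0`;
* pendant `a₃` (`TypedPendantA3.typedCount_pendant_a3_quadratic`): `N_2 − N_3 = N_1 − N_0`, i.e.
  (T23) there IS the candidate row (PM).

So the content of (T23) sits on the REDUCED instances (no loop / root pair / unmarked leaf / pendant
`b`, `o`, and — modulo (PM) — no pendant `a₃`); the series and parallel rules are not treated here.
-/

namespace Summit.Ventures.PercRepro2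

namespace CovForm

namespace TypedRed

variable {V : Type*} {E : Type*} [Fintype E] [DecidableEq E] {R : Type*} [Field R]
  [LinearOrder R] [IsStrictOrderedRing R]
variable (ends : E → Sym2 V) (o a₁ a₂ a₃ b : V)

/-- **(T23) at an unmarked leaf edge**, given the base with the edge closed is nonnegative. -/
theorem t23_unmarked_leaf {f : E} {l u : V} (hf : ends f = s(l, u))
    (hleaf : ∀ e, l ∈ ends e → e = f) (hlu : l ≠ u) (hlo : l ≠ o) (hl1 : l ≠ a₁) (hl2 : l ≠ a₂)
    (hl3 : l ≠ a₃) (hlb : l ≠ b) (F : Finset E) (hfF : f ∈ F) (z : Config E) (τ : E → ℕ)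
    (h0 : 0 ≤ typedCount F z (Function.update τ f 0)
      (K3 ends o a₁ a₂ a₃ b : Config E → Config E → Config E → R)) :
    typedCount F z (Function.update τ f 3)
        (K3 ends o a₁ a₂ a₃ b : Config E → Config E → Config E → R) ≤
      typedCount F z (Function.update τ f 2) (K3 ends o a₁ a₂ a₃ b) := by
  have h2 := typedCount_unmarked_leaf ends o a₁ a₂ a₃ b hf hleaf hlu hlo hl1 hl2 hl3 hlb F hfF z
    (Function.update τ f 2) (R := R)
  have h3 := typedCount_unmarked_leaf ends o a₁ a₂ a₃ b hf hleaf hlu hlo hl1 hl2 hl3 hlb F hfF z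
    (Function.update τ f 3) (R := R)
  rw [Function.update_self, Function.update_idem] at h2 h3
  rw [h2, h3]
  norm_num
  linarith

/-- **(T23) at a typed loop**, given the base with the loop closed is nonnegative. -/
theorem t23_loop {f : E} {u : V} (hf : ends f = s(u, u)) (F : Finset E) (hfF : f ∈ F)
    (z : Config E) (τ : E → ℕ)
    (h0 : 0 ≤ typedCount F z (Function.update τ f 0)
      (K3 ends o a₁ a₂ a₃ b : Config E → Config E → Config E → R)) :
    typedCount F z (Function.update τ f 3)
        (K3 ends o a₁ a₂ a₃ b : Config E → Config E → Config E → R) ≤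
      typedCount F z (Function.update τ f 2) (K3 ends o a₁ a₂ a₃ b) := by
  have h2 := typedCount_loop ends o a₁ a₂ a₃ b hf F hfF z (Function.update τ f 2) (R := R)
  have h3 := typedCount_loop ends o a₁ a₂ a₃ b hf F hfF z (Function.update τ f 3) (R := R)
  rw [Function.update_self, Function.update_idem] at h2 h3
  rw [h2, h3]
  norm_num
  linarith

/-- **(T23) at a pendant `b`**, given the base with `b := u` is nonnegative. -/
theorem t23_pendant_b {f : E} {u : V} (hf : ends f = s(b, u))
    (hleaf : ∀ e, b ∈ ends e → e = f) (hbu : b ≠ u) (hbo : b ≠ o) (hb1 : b ≠ a₁) (hb2 : b ≠ a₂)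
    (hb3 : b ≠ a₃) (F : Finset E) (hfF : f ∈ F) (z : Config E) (τ : E → ℕ)
    (h3 : 0 ≤ typedCount F z (Function.update τ f 3)
      (K3 ends o a₁ a₂ a₃ b : Config E → Config E → Config E → R)) :
    typedCount F z (Function.update τ f 3)
        (K3 ends o a₁ a₂ a₃ b : Config E → Config E → Config E → R) ≤
      typedCount F z (Function.update τ f 2) (K3 ends o a₁ a₂ a₃ b) := by
  have h2 := typedCount_pendant_b ends o a₁ a₂ a₃ b hf hleaf hbu hbo hb1 hb2 hb3 F hfF z
    (Function.update τ f 2) (R := R) (by rw [Function.update_self]; omega)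
  rw [Function.update_self, Function.update_idem] at h2
  rw [h2]
  norm_num
  linarith

/-- **(T23) at a pendant `o`**, given the base with `o := u` is nonnegative. -/
theorem t23_pendant_o {f : E} {u : V} (hf : ends f = s(o, u))
    (hleaf : ∀ e, o ∈ ends e → e = f) (hou : o ≠ u) (ho1 : o ≠ a₁) (ho2 : o ≠ a₂) (ho3 : o ≠ a₃)
    (hob : o ≠ b) (F : Finset E) (hfF : f ∈ F) (z : Config E) (τ : E → ℕ)
    (h3 : 0 ≤ typedCount F z (Function.update τ f 3)
      (K3 ends o a₁ a₂ a₃ b : Config E → Config E → Config E → R)) :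
    typedCount F z (Function.update τ f 3)
        (K3 ends o a₁ a₂ a₃ b : Config E → Config E → Config E → R) ≤
      typedCount F z (Function.update τ f 2) (K3 ends o a₁ a₂ a₃ b) := by
  have h2 := typedCount_pendant_o ends o a₁ a₂ a₃ b hf hleaf hou ho1 ho2 ho3 hob F hfF z
    (Function.update τ f 2) (R := R) (by rw [Function.update_self]; omega)
  rw [Function.update_self, Function.update_idem] at h2
  rw [h2]
  norm_num
  linarith

omit [LinearOrder R] [IsStrictOrderedRing R] in
/-- **(T23) at a root pair**: both bases vanish. -/
theorem t23_root_pair_eq {f : E} (hf : ends f = s(a₁, a₂)) (F : Finset E) (hfF : f ∈ F)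
    (z : Config E) (τ : E → ℕ) :
    typedCount F z (Function.update τ f 3)
        (K3 ends o a₁ a₂ a₃ b : Config E → Config E → Config E → R) =
      typedCount F z (Function.update τ f 2) (K3 ends o a₁ a₂ a₃ b) := by
  rw [typedCount_root_pair ends o a₁ a₂ a₃ b hf F hfF z _ (by rw [Function.update_self]; omega),
    typedCount_root_pair ends o a₁ a₂ a₃ b hf F hfF z _ (by rw [Function.update_self]; omega)]

/-- **(T23) at a pendant `a₃` is the row (PM)**: `N_2 − N_3 = N_1 − N_0`. -/
theorem t23_pendant_a3_iff_PM {f : E} {u : V} (hf : ends f = s(a₃, u))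
    (hleaf : ∀ e, a₃ ∈ ends e → e = f) (h3u : a₃ ≠ u) (h3o : a₃ ≠ o) (h31 : a₃ ≠ a₁)
    (h32 : a₃ ≠ a₂) (h3b : a₃ ≠ b) (F : Finset E) (hfF : f ∈ F) (z : Config E) (τ : E → ℕ) :
    (typedCount F z (Function.update τ f 3)
        (K3 ends o a₁ a₂ a₃ b : Config E → Config E → Config E → R) ≤
      typedCount F z (Function.update τ f 2) (K3 ends o a₁ a₂ a₃ b)) ↔
    (typedCount F z (Function.update τ f 0)
        (K3 ends o a₁ a₂ a₃ b : Config E → Config E → Config E → R) ≤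
      typedCount F z (Function.update τ f 1) (K3 ends o a₁ a₂ a₃ b)) := by
  have hq := typedCount_pendant_a3_quadratic (R := R) ends o a₁ a₂ a₃ b hf hleaf h3u h3o h31 h32
    h3b F hfF z τ
  constructor <;> intro h <;> linarith

end TypedRed

end CovForm

end Summit.Ventures.PercRepro2
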